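import Summits.Ventures.HSemireg.WedgeHankelSubstitutionFrameEigen
import Summits.Ventures.HSemireg.WedgeHankelSubstitutionClassSpace

/-!
# Venture HSemireg — UPPER substitutions (`γ = 0`, node `∞` fixed) with a second fixed node `λ₁ ∈ K` are DIAGONALIZABLE on th-7's class space, basis-free: an eigenbasis
# `Sb 1 λ₁ 0 1 (E_p)` of `spikeSpan n` with the weights `α^{n−p}δ^p`, the eigenspaces exhaust the class space, and for pairwise distinct weights `minpoly = Π_p (X − α^{n−p}δ^p) =
# charpoly` — the `∞` companion of `WedgeHankelSubstitutionSemisimple`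

HONEST FRAMING. Part of the Lean index of the computation cell `pub-hsemireg` (seat p10 gen 20, Sunday typer «UNIFORM-IN-n»).
Finite-dimensional EXTERIOR ALGEBRA + linear algebra ONLY: no variety, no cohomology theory, no sheaf, no Ext group, no semiregularity map;
nothing here says that HC / HC_CM / HC_AV holds; no Literature fact is declared or used.  Custodian versions as in `WedgeHankelSiegelIdeal` (1/3) and `WedgeHankelFrameChange`.

WHAT IS IN THE TREE.  I6 (`WedgeHankelSubstitutionFrameEigen`), `∞` family: `linearIndependent_frame_spike_infty`, `span_frame_spike_infty_eq_coSiegel`, `Sb_frame_spike_eigen_infty_top`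
(`Sb α β 0 δ (Sb 1 λ₁ 0 1 E_p) = α^{n−p}δ^p · Sb 1 λ₁ 0 1 E_p` for `β + λ₁δ = λ₁α`); I11 `charpoly_SbC_of_fixed_one`; the companion file `WedgeHankelSubstitutionSemisimple` (this seat, J17)
does two FINITE nodes.  THIS FILE (namespace `Summit.Ventures.HSemireg.Wedge.HankelFrameChange` continued; imports I6, I11):
* §266 `frame_spike_infty_mem_spikeSpan`, `linearIndependent_frame_spike_infty_spikeSpan`, `span_frame_spike_infty_spikeSpan_eq_top`, **`exists_eigenbasis_SbC_of_upper`**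
  (eigenBASIS of `spikeSpan n` for `SbC(α β 0 δ)` with weights `α^{n−p}δ^p`, whenever `β + λ₁δ = λ₁α` for some `λ₁ ∈ K` — e.g. `λ₁ = β/(α−δ)` for `α ≠ δ`, or `β = 0`),
  `hasEigenvalue_SbC_weight_of_upper`, **`iSup_eigenspace_SbC_eq_top_of_upper`**, `exists_fixed_node_of_ne` (`α ≠ δ ⇒ λ₁ = β/(α − δ)` works).
* §267 **`prod_SbC_sub_weight_eq_zero_of_upper`** (`Π_p (SbC(g) − α^{n−p}δ^p) = 0`), `minpoly_SbC_dvd_prod_of_upper`, **`minpoly_SbC_of_upper_of_injective`** (distinct weights ⇒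
  `minpoly = Π_p (X − C(α^{n−p}δ^p))`), and the DIAGONAL TORUS `SbC(a 0 0 d)` (`β = 0`, `λ₁ = 0`): `exists_eigenbasis_SbC_diag`, `minpoly_SbC_diag_of_injective`.
NOT typed here: anything Ext-side.  New names only.
-/

open Module

namespace Summit.Ventures.HSemireg.Wedge.HankelFrameChange

open Summit.Ventures.HSemireg.Wedge Summit.Ventures.HSemireg.Wedge.Kunneth Summit.Ventures.HSemireg.Wedge.Hankel
  Summit.Ventures.HSemireg.Wedge.BasisFree Summit.Ventures.HSemireg.Wedge.HankelSiegel Summit.Ventures.HSemireg.Wedge.HankelSiegelIdeal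
  Summit.Ventures.HSemireg.Wedge.KunnethKernel Summit.Ventures.HSemireg.Wedge.HankelRankOne Summit.Ventures.HSemireg.Wedge.KernelDuality

variable (K : Type*) [Field K] {n : ℕ}

/-! ## §266. The `∞`-frame classes as an eigenbasis -/

/-- the `∞`-frame classes lie in the class space. -/
theorem frame_spike_infty_mem_spikeSpan (l₁ : K) (p : Fin (n + 1)) :
    Sb K 1 l₁ 0 1 (w K n n (fun j => if j = (p : ℕ) then (1 : K) else 0)) ∈ spikeSpan K n := by
  rw [spikeSpan_eq_coSiegel]; exact Sb_w_mem_coSiegel K 1 l₁ 0 1 _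

/-- they are linearly independent in the class space. -/
theorem linearIndependent_frame_spike_infty_spikeSpan (l₁ : K) :
    LinearIndependent K (fun p : Fin (n + 1) => (⟨Sb K 1 l₁ 0 1 (w K n n (fun j => if j = (p : ℕ) then (1 : K) else 0)), frame_spike_infty_mem_spikeSpan K l₁ p⟩ : spikeSpan K n)) := by
  apply LinearIndependent.of_comp (spikeSpan K n).subtype
  exact linearIndependent_frame_spike_infty K l₁

/-- they span the class space. -/
theorem span_frame_spike_infty_spikeSpan_eq_top (l₁ : K) :
    Submodule.span K (Set.range fun p : Fin (n + 1) =>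
      (⟨Sb K 1 l₁ 0 1 (w K n n (fun j => if j = (p : ℕ) then (1 : K) else 0)), frame_spike_infty_mem_spikeSpan K l₁ p⟩ : spikeSpan K n)) = ⊤ := by
  apply Submodule.map_injective_of_injective (spikeSpan K n).injective_subtype
  rw [Submodule.map_subtype_top, Submodule.map_span, ← Set.range_comp]
  have e : ((spikeSpan K n).subtype ∘ fun p : Fin (n + 1) =>
      (⟨Sb K 1 l₁ 0 1 (w K n n (fun j => if j = (p : ℕ) then (1 : K) else 0)), frame_spike_infty_mem_spikeSpan K l₁ p⟩ : spikeSpan K n)) =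
      fun p : Fin (n + 1) => Sb K 1 l₁ 0 1 (w K n n (fun j => if j = (p : ℕ) then (1 : K) else 0)) := rfl
  rw [e, span_frame_spike_infty_eq_coSiegel K l₁, spikeSpan_eq_coSiegel]

/-- **AN EIGENBASIS OF THE CLASS SPACE FOR AN UPPER SUBSTITUTION `SbC(α β 0 δ)` WITH A FINITE FIXED NODE `λ₁` (`β + λ₁δ = λ₁α`): `b p = Sb 1 λ₁ 0 1 (E_p)`, weights `α^{n−p}δ^p`.** -/
theorem exists_eigenbasis_SbC_of_upper {α β δ l₁ : K} (e₁ : β + l₁ * δ = l₁ * α) :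
    ∃ b : Basis (Fin (n + 1)) K (spikeSpan K n), ∀ p : Fin (n + 1), SbC K α β 0 δ (b p) = (α ^ (n - (p : ℕ)) * δ ^ (p : ℕ)) • b p := by
  refine ⟨Basis.mk (linearIndependent_frame_spike_infty_spikeSpan K l₁) (span_frame_spike_infty_spikeSpan_eq_top K l₁).ge, fun p => ?_⟩
  rw [Basis.mk_apply]
  exact Subtype.ext (by rw [SbC_apply_coe, Submodule.coe_smul]; exact Sb_frame_spike_eigen_infty_top K e₁ p)

/-- for `α ≠ δ` the node `λ₁ = β/(α − δ)` is fixed. -/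
theorem exists_fixed_node_of_ne {α δ : K} (h : α ≠ δ) (β : K) : β + β / (α - δ) * δ = β / (α - δ) * α := by
  have hαδ : α - δ ≠ 0 := sub_ne_zero.mpr h
  field_simp
  ring

/-- each weight `α^{n−p}δ^p` is an eigenvalue. -/
theorem hasEigenvalue_SbC_weight_of_upper {α β δ l₁ : K} (e₁ : β + l₁ * δ = l₁ * α) (p : Fin (n + 1)) :
    Module.End.HasEigenvalue (SbC K α β 0 δ (n := n)) (α ^ (n - (p : ℕ)) * δ ^ (p : ℕ)) := by
  obtain ⟨b, hb⟩ := exists_eigenbasis_SbC_of_upper K (n := n) e₁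
  exact Module.End.hasEigenvalue_of_hasEigenvector (Module.End.hasEigenvector_iff.mpr ⟨Module.End.mem_eigenspace_iff.mpr (hb p), b.ne_zero p⟩)

/-- **the eigenspaces exhaust the class space.** -/
theorem iSup_eigenspace_SbC_eq_top_of_upper {α β δ l₁ : K} (e₁ : β + l₁ * δ = l₁ * α) :
    ⨆ μ : K, Module.End.eigenspace (SbC K α β 0 δ (n := n)) μ = ⊤ := by
  obtain ⟨b, hb⟩ := exists_eigenbasis_SbC_of_upper K (n := n) e₁
  rw [eq_top_iff, ← b.span_eq, Submodule.span_le]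
  rintro _ ⟨p, rfl⟩
  exact Submodule.mem_iSup_of_mem _ (Module.End.mem_eigenspace_iff.mpr (hb p))

/-! ## §267. The annihilating product, the minimal polynomial, the diagonal torus -/

/-- **`Π_p (SbC(α β 0 δ) − α^{n−p}δ^p) = 0`** (Cayley–Hamilton with I11's characteristic polynomial for the fixed node `λ₁`). -/
theorem prod_SbC_sub_weight_eq_zero_of_upper {α β δ l₁ : K} (e₁ : β + l₁ * δ = l₁ * α) :
    Polynomial.aeval (SbC K α β 0 δ (n := n)) (∏ p : Fin (n + 1), (Polynomial.X - Polynomial.C (α ^ (n - (p : ℕ)) * δ ^ (p : ℕ)))) = 0 := by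
  have e₁' : β + l₁ * δ = l₁ * (α + l₁ * 0) := by rw [mul_zero, add_zero]; exact e₁
  have h := LinearMap.aeval_self_charpoly (SbC K α β 0 δ (n := n))
  rw [charpoly_SbC_of_fixed_one K e₁'] at h
  simpa only [mul_zero, add_zero, sub_zero] using h

/-- `minpoly ∣ Π_p (X − C(α^{n−p}δ^p))`. -/
theorem minpoly_SbC_dvd_prod_of_upper {α β δ l₁ : K} (e₁ : β + l₁ * δ = l₁ * α) :
    minpoly K (SbC K α β 0 δ (n := n)) ∣ ∏ p : Fin (n + 1), (Polynomial.X - Polynomial.C (α ^ (n - (p : ℕ)) * δ ^ (p : ℕ))) :=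
  minpoly.dvd K _ (prod_SbC_sub_weight_eq_zero_of_upper K e₁)

/-- **pairwise distinct weights `α^{n−p}δ^p` ⇒ `minpoly(SbC(α β 0 δ)) = Π_p (X − C(α^{n−p}δ^p))`.** -/
theorem minpoly_SbC_of_upper_of_injective {α β δ l₁ : K} (e₁ : β + l₁ * δ = l₁ * α) (hμ : Function.Injective fun p : Fin (n + 1) => α ^ (n - (p : ℕ)) * δ ^ (p : ℕ)) :
    minpoly K (SbC K α β 0 δ (n := n)) = ∏ p : Fin (n + 1), (Polynomial.X - Polynomial.C (α ^ (n - (p : ℕ)) * δ ^ (p : ℕ))) := by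
  have hT : IsIntegral K (SbC K α β 0 δ (n := n)) := Algebra.IsIntegral.isIntegral _
  have h1 := minpoly_SbC_dvd_prod_of_upper K (n := n) e₁
  have h2 : (∏ p : Fin (n + 1), (Polynomial.X - Polynomial.C (α ^ (n - (p : ℕ)) * δ ^ (p : ℕ)))) ∣ minpoly K (SbC K α β 0 δ (n := n)) := by
    refine Finset.prod_dvd_of_coprime (fun p _ p' _ hpp' => Polynomial.pairwise_coprime_X_sub_C hμ hpp') fun p _ => ?_
    exact Polynomial.dvd_iff_isRoot.mpr (Module.End.isRoot_of_hasEigenvalue (hasEigenvalue_SbC_weight_of_upper K e₁ p))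
  exact Polynomial.eq_of_monic_of_associated (minpoly.monic hT) (Polynomial.monic_prod_of_monic _ _ fun p _ => Polynomial.monic_X_sub_C _) (associated_of_dvd_dvd h1 h2)

/-- **THE DIAGONAL TORUS: an eigenbasis for `SbC(a 0 0 d)`** (`β = 0`, fixed nodes `0` and `∞`; th-7's own spikes up to the identity frame change `Sb 1 0 0 1`). -/
theorem exists_eigenbasis_SbC_diag (a d : K) :
    ∃ b : Basis (Fin (n + 1)) K (spikeSpan K n), ∀ p : Fin (n + 1), SbC K a 0 0 d (b p) = (a ^ (n - (p : ℕ)) * d ^ (p : ℕ)) • b p :=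
  exists_eigenbasis_SbC_of_upper K (l₁ := 0) (by rw [zero_mul, zero_mul, add_zero])

/-- distinct torus weights ⇒ `minpoly(SbC(a 0 0 d)) = Π_p (X − C(a^{n−p}d^p))`. -/
theorem minpoly_SbC_diag_of_injective {a d : K} (hμ : Function.Injective fun p : Fin (n + 1) => a ^ (n - (p : ℕ)) * d ^ (p : ℕ)) :
    minpoly K (SbC K a 0 0 d (n := n)) = ∏ p : Fin (n + 1), (Polynomial.X - Polynomial.C (a ^ (n - (p : ℕ)) * d ^ (p : ℕ))) :=
  minpoly_SbC_of_upper_of_injective K (l₁ := 0) (by rw [zero_mul, zero_mul, add_zero]) hμ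

end Summit.Ventures.HSemireg.Wedge.HankelFrameChange
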